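import Literature.IUT.HodgeArakelov.GaloisPairCyclotomesThetaSyncThetaSide
import HarnessLib

/-!
# [IUTchII] Cor. 1.11 (b), theta side of the residual (C′) at Cor. 1.10's genuine family: `ρ_A(γ)` acts on
# `(l·Δ_Θ)(𝕄_*) ≅ Λ(ℚ̄_pˣ)` levelwise by the COEFFICIENT AUTOMORPHISMS `γ̄_{μ,M}` of [EtTh] Cor. 2.19

Mochizuki, *Inter-universal Teichmüller theory II*, §1, Cor. 1.11 (b), kurims manuscript (Dec. 2020) p. 49
[claim: Mochizuki2012, status: disputed] (IUTchII §1 Cor 1.11, kurims p.49); *The étale theta function …*, Cor. 2.18 (i)/(iv),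
Cor. 2.19 (i)/(iii) pp. 60–65 [cite: MochizukiEtTh2009, Cor 2.19(i) p.64]. abc-iut cell, layer L6, node `IUTchII:Cor1.11`; seat
abc-iut-w5-d145 (gen 4), support chain «CW5D145-CONSOLIDATE» piece P3 for GAP-LEDGER **G-w5d145-2**. PROOF-ONLY, 0 defs.

abc-iut-w5-d145 gen 3 proved (E_Θ) (`exists_thetaSide_equivariant`, p432181): `t : (l·Δ_Θ)(𝕄_*) ⥲ Π_μ(𝕄_*) ⥲ Λ(ℚ̄_pˣ)` carries
the conjugation action `act_A(x)` to the field action of `aug(x)`. THIS FILE adds the companion formula for the TRANSPORT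
`ρ_A(γ) = rhoALim γ` of a topological automorphism `γ` of `Π^tp_{X̲̲}` (the other actor of the residual (C′)), GIVEN [EtTh]
Cor. 2.18 (i) at every level BY NAME (`h218i : ∀ M, (levelRigid … M).Cor218_i`, the family's named input):
`EtaleLevels.exists_thetaSide_natural` — `t` may be chosen with (1) the (E_Θ) formula AND (2) for every `γ`, `m`, `n`:
`(t m)_n = a` and `(t (ρ_A(γ) m))_n = γ̄_{μ,n}(a)` for the level-`n` `μ`-coordinate `a ∈ μ_n` of `(∗mono-Θ)(m)`, where
`γ̄_{μ,n} = coeffAut (levelRigid … n) (h218i n) γ` is abc-iut-w5-d145's COEFFICIENT AUTOMORPHISM of [EtTh] Cor. 2.19 (iii)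
(`thetaMod_n (γ g) = γ̄_{μ,n} (thetaMod_n g)`; `ρ_B` acts levelwise by it: abc-iut-w4-d030's `rhoBLim_level`). Hence the unit
`u₂(γ)` by which `ρ_A(γ)` acts on `(l·Δ_Θ)(𝕄_*) ≅ Ẑ(1)` is read off the `γ̄_{μ,n}`: **(HCYC)_levels** «`γ̄_{μ,n} = galMuN τ` for all
`n`» (naturality of the level-`n` cyclotomic rigidity identifications under `(γ, τ)`, abc-iut-w4-d007's (HCYC) in this lineage's
vocabulary) gives `(t (ρ_A(γ) m))_n = τ (t m)_n` (`thetaSide_natural_of_hcyc`). No new `Prop` fact; nothing of another seat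
restated; nothing here bears on [IUTchIII] Cor. 3.12; typed ≠ discharged.
-/

noncomputable section

namespace Literature.IUT.HodgeArakelov

open CategoryTheory
open Literature.AnabelianGeometry.AbsoluteAnabelian

namespace EtaleLevels

open Literature.AnabelianGeometry.EtaleTheta Literature.AnabelianGeometry.SemiGraphs
open scoped Literature.AnabelianGeometry.EtaleTheta

variable {p : ℕ} [Fact p.Prime] {D : Literature.AnabelianGeometry.EtaleTheta.ThetaSetting p}
  {E : D.EtaleThetaData} {l : ℕ} (C : E.DoubleUnderline l) (hC : D.Compat) (hS : D.Sec2Hyps)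
  (hl : l.Prime) (hp2 : p ≠ 2) (hpl : p ≠ l) (hζ : ∃ ζ : D.K, IsPrimitiveRoot ζ (4 * l))
  (mods : ∀ M : ℕ+, D.CyclotomeMod l M)
  (f : contCocycles D.toTheta D.DeltaTheta C.GtpYdduu) (hf : f ∈ C.rootCocycles hC)
  (hmods : ∀ (M M' : ℕ+) (h : (M : ℕ) ∣ (M' : ℕ)) (x : D.lDeltaTheta l),
    MuN.red p M M' h ((mods M').red x) = (mods M).red x)
  (h15 : Literature.AnabelianGeometry.EtaleTheta.ThetaSetting.Prop15iii E hC) (L : C.CuspLabels)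
  (hZ : ∀ M : ℕ+, Nonempty (ModelCyclotomes.lDeltaQuot (C.rigidData (mods M) hC hS h15 L) ≃*
    Literature.IUT.HodgeTheaters.ZHat))
  (h218i : ∀ M : ℕ+, (levelRigid C hC hS mods h15 L M).Cor218_i)

/-- Every level coordinate of `y ∈ Π_μ(𝕄_*)` lies in `μ_n ⊆ μ_n ⋊ Π^tp_{Y̲̲}`: `y_n = inMu (y_n).left`.
[claim: Mochizuki2012, status: disputed] (IUTchII §1 Prop 1.5 (iii), kurims p.29) -/
theorem extCycLim_coord_eq_inMu_left (y : ↥(modelSystem C hC hS hl hp2 hpl hζ mods f hf hmods h15 L hZ).extCycLim) (n : ℕ+) :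
    ((y : ∀ M, ((modelSystem C hC hS hl hp2 hpl hζ mods f hf hmods h15 L hZ).env M).Pi) n : (levelData C hC hS mods n).env) =
      CycEnvelope.inMu (levelData C hC hS mods n).augY (levelData C hC hS mods n).chi
        (((y : ∀ M, ((modelSystem C hC hS hl hp2 hpl hζ mods f hf hmods h15 L hZ).env M).Pi) n :
          (levelData C hC hS mods n).env)).left := by
  refine SemidirectProduct.ext ?_ ?_
  · rw [SemidirectProduct.left_inl]
  · rw [SemidirectProduct.right_inl, extCycLim_right_eq_one]

/-- **(E_Θ) together with the LEVELWISE FORMULA FOR `ρ_A(γ)`** at Cor. 1.10's genuine family, given [EtTh] Cor. 2.18 (i) at every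
level: there is `t : (l·Δ_Θ)(𝕄_*) ⥲ Λ(ℚ̄_pˣ)` with (1) `t(act_A(x) m)_n = aug(x)((t m)_n)` and (2) for every topological automorphism
`γ` of `Π^tp_{X̲̲}`, every `m` and every level `n`, the `n`-th coordinates of `t m` and `t (ρ_A(γ) m)` are `a` and `γ̄_{μ,n}(a)` for
some `a ∈ μ_n`, `γ̄_{μ,n} = coeffAut (levelRigid … n) (h218i n) γ` the coefficient automorphism of [EtTh] Cor. 2.19 (iii).
[claim: Mochizuki2012, status: disputed] (IUTchII §1 Cor 1.11, kurims p.49) -/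
theorem exists_thetaSide_natural :
    ∃ t : ↥(baseDatumLim C hC hS hl hp2 hpl hζ mods f hf hmods h15 L hZ (h218i 1)).A ≃*
        ↥(Literature.AnabelianGeometry.EtaleTheta.cyclotome (AlgebraicClosure ℚ_[p])ˣ),
      (∀ (x : (basePointLim C hC hS hl hp2 hpl hζ mods f hf hmods h15 L hZ).G)
          (m : ↥(baseDatumLim C hC hS hl hp2 hpl hζ mods f hf hmods h15 L hZ (h218i 1)).A) (n : ℕ+),
        ((((t ((baseDatumLim C hC hS hl hp2 hpl hζ mods f hf hmods h15 L hZ (h218i 1)).actA x m) :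
            ↥(Literature.AnabelianGeometry.EtaleTheta.cyclotome (AlgebraicClosure ℚ_[p])ˣ)) :
            ℕ+ → (AlgebraicClosure ℚ_[p])ˣ) n : (AlgebraicClosure ℚ_[p])ˣ) : AlgebraicClosure ℚ_[p]) =
          (D.aug (Subtype.val x))
            ((((t m : ↥(Literature.AnabelianGeometry.EtaleTheta.cyclotome (AlgebraicClosure ℚ_[p])ˣ)) :
              ℕ+ → (AlgebraicClosure ℚ_[p])ˣ) n : (AlgebraicClosure ℚ_[p])ˣ) : AlgebraicClosure ℚ_[p])) ∧
      ∀ (γ : (basePointLim C hC hS hl hp2 hpl hζ mods f hf hmods h15 L hZ).G ≃ₜ*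
            (basePointLim C hC hS hl hp2 hpl hζ mods f hf hmods h15 L hZ).G)
        (m : ↥(baseDatumLim C hC hS hl hp2 hpl hζ mods f hf hmods h15 L hZ (h218i 1)).A) (n : ℕ+),
        ∃ a : MuN p n,
          ((t m : ↥(Literature.AnabelianGeometry.EtaleTheta.cyclotome (AlgebraicClosure ℚ_[p])ˣ)) :
              ℕ+ → (AlgebraicClosure ℚ_[p])ˣ) n = ((a : MuN p n) : (PadicAlgCl p)ˣ) ∧
          ((t ((baseDatumLim C hC hS hl hp2 hpl hζ mods f hf hmods h15 L hZ (h218i 1)).rhoA γ m) :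
              ↥(Literature.AnabelianGeometry.EtaleTheta.cyclotome (AlgebraicClosure ℚ_[p])ˣ)) :
              ℕ+ → (AlgebraicClosure ℚ_[p])ˣ) n =
            ((ModelCyclotomes.coeffAut (S := levelSetting C hC hS hl hp2 hpl hζ mods f hf n) (levelRigid C hC hS mods h15 L n)
              (h218i n) γ a : MuN p n) : (PadicAlgCl p)ˣ) := by
  obtain ⟨Φ, hΦ⟩ := exists_extCycLim_mulEquiv_cyclotome C hC hS hl hp2 hpl hζ mods f hf hmods h15 L hZ
  refine ⟨(rigidLimEquiv C hC hS hl hp2 hpl hζ mods f hf hmods h15 L hZ).trans Φ, fun x m n => ?_, fun γ m n => ?_⟩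
  · -- (1): verbatim the gen-3 argument of `exists_thetaSide_equivariant`
    have h1 : rigidLimEquiv C hC hS hl hp2 hpl hζ mods f hf hmods h15 L hZ
          ((baseDatumLim C hC hS hl hp2 hpl hζ mods f hf hmods h15 L hZ (h218i 1)).actA x m) =
        actExtLim C hC hS hl hp2 hpl hζ mods f hf hmods h15 L hZ x (rigidLimEquiv C hC hS hl hp2 hpl hζ mods f hf hmods h15 L hZ m) := by
      rw [actExtLim_apply, MulEquiv.symm_apply_apply]
      rfl
    change ((((Φ (rigidLimEquiv C hC hS hl hp2 hpl hζ mods f hf hmods h15 L hZ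
        ((baseDatumLim C hC hS hl hp2 hpl hζ mods f hf hmods h15 L hZ (h218i 1)).actA x m)) :
          ↥(Literature.AnabelianGeometry.EtaleTheta.cyclotome (AlgebraicClosure ℚ_[p])ˣ)) :
          ℕ+ → (AlgebraicClosure ℚ_[p])ˣ) n : (AlgebraicClosure ℚ_[p])ˣ) : AlgebraicClosure ℚ_[p]) =
      (D.aug (Subtype.val x))
        ((((Φ (rigidLimEquiv C hC hS hl hp2 hpl hζ mods f hf hmods h15 L hZ m) :
          ↥(Literature.AnabelianGeometry.EtaleTheta.cyclotome (AlgebraicClosure ℚ_[p])ˣ)) :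
          ℕ+ → (AlgebraicClosure ℚ_[p])ˣ) n : (AlgebraicClosure ℚ_[p])ˣ) : AlgebraicClosure ℚ_[p])
    rw [h1, hΦ, hΦ, actExtLim_left, galMuN_apply_coe]
  · -- (2): `ρ_A(γ)` through `(∗mono-Θ)` is `ρ_B(γ)`, which acts on the level-`n` coordinate by `γ̄_{μ,n}`
    set y := rigidLimEquiv C hC hS hl hp2 hpl hζ mods f hf hmods h15 L hZ m with hy
    refine ⟨(((y : ∀ M, ((modelSystem C hC hS hl hp2 hpl hζ mods f hf hmods h15 L hZ).env M).Pi) n :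
        (levelData C hC hS mods n).env)).left, ?_, ?_⟩
    · exact hΦ y n
    · have h1 : rigidLimEquiv C hC hS hl hp2 hpl hζ mods f hf hmods h15 L hZ
            ((baseDatumLim C hC hS hl hp2 hpl hζ mods f hf hmods h15 L hZ (h218i 1)).rhoA γ m) =
          rhoBLim C hC hS hl hp2 hpl hζ mods f hf hmods h15 L hZ (h218i 1) γ y :=
        (rhoBLim_rigidLimEquiv C hC hS hl hp2 hpl hζ mods f hf hmods h15 L hZ (h218i 1) γ m).symm
      have h2 := rhoBLim_level C hC hS hl hp2 hpl hζ mods f hf hmods h15 L hZ (h218i 1) n (h218i n) γ y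
        (((y : ∀ M, ((modelSystem C hC hS hl hp2 hpl hζ mods f hf hmods h15 L hZ).env M).Pi) n :
          (levelData C hC hS mods n).env)).left
        (extCycLim_coord_eq_inMu_left C hC hS hl hp2 hpl hζ mods f hf hmods h15 L hZ y n)
      have h3 := congrArg (fun w : (levelData C hC hS mods n).env => ((w.left : MuN p n) : (PadicAlgCl p)ˣ)) h2
      change ((Φ (rigidLimEquiv C hC hS hl hp2 hpl hζ mods f hf hmods h15 L hZ
          ((baseDatumLim C hC hS hl hp2 hpl hζ mods f hf hmods h15 L hZ (h218i 1)).rhoA γ m)) :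
            ↥(Literature.AnabelianGeometry.EtaleTheta.cyclotome (AlgebraicClosure ℚ_[p])ˣ)) :
            ℕ+ → (AlgebraicClosure ℚ_[p])ˣ) n = _
      rw [h1, hΦ]
      refine h3.trans ?_
      change (((SemidirectProduct.inl _ : (levelData C hC hS mods n).env).left : MuN p n) : (PadicAlgCl p)ˣ) = _
      rw [SemidirectProduct.left_inl]

include hmods hZ in
/-- **The theta half of (C′) under (HCYC)_levels**: if the coefficient automorphisms of `γ` ARE the Galois action of `τ ∈ G_{ℚ_p}`
on roots of unity at every level (`γ̄_{μ,n} = galMuN τ` — naturality of the level-`n` cyclotomic rigidity identifications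
`thetaMod_n : l·Δ_Θ ↠ μ_n` under `(γ, τ)`; abc-iut-w4-d007's (HCYC) in the levelRigid vocabulary), then for the `t` of
`exists_thetaSide_natural`-shape, `(t (ρ_A(γ) m))_n = τ((t m)_n)`: the unit `u₂(γ)` of `ρ_A(γ)` on `(l·Δ_Θ)(𝕄_*) ≅ Ẑ(1)` IS the
cyclotomic character of `τ`. [claim: Mochizuki2012, status: disputed] (IUTchII §1 Cor 1.11, kurims p.49) -/
theorem thetaSide_natural_of_hcyc
    (t : ↥(baseDatumLim C hC hS hl hp2 hpl hζ mods f hf hmods h15 L hZ (h218i 1)).A ≃*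
        ↥(Literature.AnabelianGeometry.EtaleTheta.cyclotome (AlgebraicClosure ℚ_[p])ˣ))
    (γ : (basePointLim C hC hS hl hp2 hpl hζ mods f hf hmods h15 L hZ).G ≃ₜ*
        (basePointLim C hC hS hl hp2 hpl hζ mods f hf hmods h15 L hZ).G)
    (ht : ∀ (m : ↥(baseDatumLim C hC hS hl hp2 hpl hζ mods f hf hmods h15 L hZ (h218i 1)).A) (n : ℕ+),
        ∃ a : MuN p n,
          ((t m : ↥(Literature.AnabelianGeometry.EtaleTheta.cyclotome (AlgebraicClosure ℚ_[p])ˣ)) :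
              ℕ+ → (AlgebraicClosure ℚ_[p])ˣ) n = ((a : MuN p n) : (PadicAlgCl p)ˣ) ∧
          ((t ((baseDatumLim C hC hS hl hp2 hpl hζ mods f hf hmods h15 L hZ (h218i 1)).rhoA γ m) :
              ↥(Literature.AnabelianGeometry.EtaleTheta.cyclotome (AlgebraicClosure ℚ_[p])ˣ)) :
              ℕ+ → (AlgebraicClosure ℚ_[p])ˣ) n =
            ((ModelCyclotomes.coeffAut (S := levelSetting C hC hS hl hp2 hpl hζ mods f hf n) (levelRigid C hC hS mods h15 L n)
              (h218i n) γ a : MuN p n) : (PadicAlgCl p)ˣ))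
    (τ : GQp p)
    (hcyc : ∀ (n : ℕ+) (a : MuN p n),
      ModelCyclotomes.coeffAut (S := levelSetting C hC hS hl hp2 hpl hζ mods f hf n) (levelRigid C hC hS mods h15 L n)
        (h218i n) γ a = galMuN p n τ a)
    (m : ↥(baseDatumLim C hC hS hl hp2 hpl hζ mods f hf hmods h15 L hZ (h218i 1)).A) (n : ℕ+) :
    ((((t ((baseDatumLim C hC hS hl hp2 hpl hζ mods f hf hmods h15 L hZ (h218i 1)).rhoA γ m) :
        ↥(Literature.AnabelianGeometry.EtaleTheta.cyclotome (AlgebraicClosure ℚ_[p])ˣ)) :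
        ℕ+ → (AlgebraicClosure ℚ_[p])ˣ) n : (AlgebraicClosure ℚ_[p])ˣ) : AlgebraicClosure ℚ_[p]) =
      τ ((((t m : ↥(Literature.AnabelianGeometry.EtaleTheta.cyclotome (AlgebraicClosure ℚ_[p])ˣ)) :
        ℕ+ → (AlgebraicClosure ℚ_[p])ˣ) n : (AlgebraicClosure ℚ_[p])ˣ) : AlgebraicClosure ℚ_[p]) := by
  obtain ⟨a, ha, hρ⟩ := ht m n
  rw [hρ, ha, hcyc n a, galMuN_apply_coe]

/-- **(HCYC)_levels from the naturality of `thetaMod`**: if at level `n` the cyclotomic rigidity identification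
`thetaMod_n : φ⁻¹(l·Δ_Θ) ↠ μ_n` ([EtTh] Def. 2.13 / Cor. 2.19) satisfies `thetaMod_n (γ g) = τ (thetaMod_n g)`, then the
coefficient automorphism `γ̄_{μ,n}` IS `galMuN τ` (uniqueness: `thetaMod_n` is surjective onto `μ_n`).
[cite: MochizukiEtTh2009, Cor 2.19(iii) p.65] -/
theorem coeffAut_eq_galMuN_of_thetaMod_natural (n : ℕ+)
    (γ : (levelRigid C hC hS mods h15 L n).PiX ≃ₜ* (levelRigid C hC hS mods h15 L n).PiX) (τ : GQp p)
    (hnat : ∀ (g : ↥(levelRigid C hC hS mods h15 L n).lDeltaTheta) (hg : γ g ∈ (levelRigid C hC hS mods h15 L n).lDeltaTheta),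
      (levelRigid C hC hS mods h15 L n).thetaMod ⟨γ g, hg⟩ = galMuN p n τ ((levelRigid C hC hS mods h15 L n).thetaMod g))
    (a : MuN p n) :
    ModelCyclotomes.coeffAut (S := levelSetting C hC hS hl hp2 hpl hζ mods f hf n) (levelRigid C hC hS mods h15 L n)
      (h218i n) γ a = galMuN p n τ a := by
  obtain ⟨q, rfl⟩ := ModelCyclotomes.thetaModQuot_surjective (levelRigid C hC hS mods h15 L n) a
  induction q using QuotientGroup.induction_on with
  | H g =>
    rw [ModelCyclotomes.thetaModQuot_mk]
    have hg : γ g ∈ (levelRigid C hC hS mods h15 L n).lDeltaTheta := by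
      have hmem : γ g ∈ ((levelRigid C hC hS mods h15 L n).lDeltaTheta).map γ.toMulEquiv.toMonoidHom := ⟨g, g.2, rfl⟩
      rwa [((h218i n) γ).2.2.2.2.1] at hmem
    exact (ModelCyclotomes.thetaMod_coeffAut (S := levelSetting C hC hS hl hp2 hpl hζ mods f hf n)
      (levelRigid C hC hS mods h15 L n) (h218i n) γ g hg).symm.trans (hnat g hg)

end EtaleLevels

end Literature.IUT.HodgeArakelov

end
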